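import Literature.NumberTheory.EllipticCurves.QuadraticTwistLocalDataAtTwo
import Literature.NumberTheory.EllipticCurves.BarriosEtAl2025.QuadraticTwistAtTwo
import Literature.NumberTheory.EllipticCurves.QuadraticTwistPadicReduction
import Literature.NumberTheory.EllipticCurves.VariableChangePointsMap
import Literature.NumberTheory.EllipticCurves.TamagawaVariableChangeProofs
import HarnessLib

/-!
# The global (`ℚ`) Tamagawa form of Barrios et al. 2025, Thm. 5.1 (rows `I₀`) FOLLOWS from the
# local (`ℚ₂`) form — dedup bridge between the two vendored facts (proofs only)

Topic `EllipticCurves`. Two named facts transcribing the SAME printed rows (Barrios–Roy–Sahajpal–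
Tallana–Tobin–Wiersema, Res. Number Theory 11 (2025), Thm. 5.1, rows `R = I₀` of the two `ℚ₂`
tables) landed in the same gate batch (cell `b2b-bsdres`, team x11b3, crossed lines 2026-08-21):

* `Literature.NumberTheory.EllipticCurves.BarriosEtAl2025_quadraticTwist_two_of_goodReduction`
  (`QuadraticTwistLocalDataAtTwo.lean`): LOCAL form — any elliptic `E / ℚ_[2]` with good reduction,
  integer twist parameter in `2`-adic normal form (`d ≡ 1, 2, 3 (mod 4)`), Kodaira symbol AND
  Tamagawa number of `E^{(d)}`;
* `Literature.NumberTheory.EllipticCurves.BarriosEtAl2025.localTamagawaNumber_quadraticTwist_two_mem_of_goodReduction`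
  (`BarriosEtAl2025/QuadraticTwistAtTwo.lean`): GLOBAL form — `E / ℚ` with good reduction at `2`,
  ANY `d ∈ ℚ^×`, any `ℚ`-model `Wd` of the twist, `c₂(Wd) ∈ {1, 2, 4}`.

This file PROVES `global_of_local : LOCAL → GLOBAL`, so that the second fact is DERIVED from the
first (one independent cited fact for one printed theorem; cell rule 7 / referee R132.3), by the
reductions its own docstring names: every `d ∈ ℚ^×` is `m · e²` with `m ∈ ℤ`, `4 ∤ m`
(`exists_int_mul_sq_eq_and_not_four_dvd`); `W^{(m e²)} ≅ W^{(m)}` over `ℚ`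
(`exists_variableChange_quadraticTwist_mul_sq`); base change commutes with changes of variables and
with the twist (`VariableChange.baseChange_smul_eq`, `map_quadraticTwist`); `c₂` is invariant under
`ℚ₂`-changes of variables (`localTamagawaNumber_variableChange_holds`); and `W.HasGoodReductionAtPrime 2`
is by definition good reduction of the `ℤ₂`-minimal model of `W ⊗ ℚ₂`. Theorems only; no new fact;
no `sorry`. [cite: BarriosEtAl2025, Thm. 5.1, §5 tables (v(d) = 0, 1), rows I₀]
-/

noncomputable section

open scoped Classical

namespace Literature.NumberTheory.EllipticCurves

open WeierstrassCurve

/-- **`2`-adic square-class normal form of a non-zero rational**: `d = m · e²` with `m` an integer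
not divisible by `4` (so `m ≡ 1, 2` or `3 (mod 4)`) and `e ∈ ℚ^×`. Elementary (`d = ab/b²`,
`ab = ± 4^k m`). [folklore] -/
private theorem exists_int_mul_sq_eq_and_not_four_dvd {d : ℚ} (hd : d ≠ 0) :
    ∃ (m : ℤ) (e : ℚ), e ≠ 0 ∧ (m : ℚ) * e ^ 2 = d ∧
      (m ≡ 1 [ZMOD 4] ∨ m ≡ 2 [ZMOD 4] ∨ m ≡ 3 [ZMOD 4]) := by
  -- `d = a / b`, `n := a b = ± 4^k n'` with `4 ∤ n'`, so `d = (± n') · (2^k / b)²`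
  set a : ℤ := d.num with ha
  set b : ℕ := d.den with hb
  have hb0 : (b : ℚ) ≠ 0 := by rw [hb]; exact_mod_cast d.den_nz
  have hbz : (b : ℤ) ≠ 0 := by rw [hb]; exact_mod_cast d.den_nz
  have ha0 : a ≠ 0 := by rw [ha]; exact Rat.num_ne_zero.mpr hd
  have hd_eq : (a : ℚ) / b = d := by rw [ha, hb]; exact Rat.num_div_den d
  set n : ℤ := a * b with hn_def
  have hn : n ≠ 0 := mul_ne_zero ha0 hbz
  have hnabs : n.natAbs ≠ 0 := Int.natAbs_ne_zero.mpr hn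
  obtain ⟨k, n', h4, hk⟩ := Nat.exists_eq_pow_mul_and_not_dvd hnabs 4 (by norm_num)
  -- the sign
  obtain ⟨s, hs, hns⟩ : ∃ s : ℤ, (s = 1 ∨ s = -1) ∧ n = s * (n.natAbs : ℤ) := by
    rcases le_or_gt 0 n with h0 | h0
    · exact ⟨1, Or.inl rfl, by rw [one_mul, Int.natAbs_of_nonneg h0]⟩
    · exact ⟨-1, Or.inr rfl, by rw [Int.ofNat_natAbs_of_nonpos h0.le, neg_one_mul, neg_neg]⟩
  have key : (a : ℚ) * b = s * 4 ^ k * n' := by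
    have h1 : ((n : ℤ) : ℚ) = s * 4 ^ k * n' := by
      rw [hns, hk]; push_cast; ring
    rw [← h1, hn_def]; push_cast; ring
  refine ⟨s * (n' : ℤ), (2 : ℚ) ^ k / b, div_ne_zero (pow_ne_zero _ two_ne_zero) hb0, ?_, ?_⟩
  · have hkq : ((2 : ℚ) ^ k) ^ 2 = (4 : ℚ) ^ k := by
      rw [← pow_mul, mul_comm, pow_mul]; norm_num
    rw [← hd_eq, div_pow, hkq]
    field_simp
    push_cast
    linear_combination key.symm
  · -- `4 ∤ n'`, `s = ±1` ⇒ `s n' mod 4 ∈ {1,2,3}`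
    have h4' : ¬ (4 : ℤ) ∣ (n' : ℤ) := by exact_mod_cast h4
    simp only [Int.ModEq]
    rcases hs with rfl | rfl <;> omega

/-- **Dedup bridge: the LOCAL vendored form of Barrios et al. 2025 Thm. 5.1 (rows `I₀`) implies the
GLOBAL one.** For `W / ℚ` elliptic with good reduction at `2`, `d ∈ ℚ^×` and any model `Wd` of the
twist `W^{(d)}` over `ℚ`: write `d = m e²` with `m ∈ ℤ`, `4 ∤ m`; then
`Wd ⊗ ℚ₂ ≅ (W ⊗ ℚ₂)^{(m)}` by a `ℚ₂`-change of variables, `c₂` is model-independent, and the local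
fact gives `c₂ ∈ {1, 2, 4}` in each of the three classes `m ≡ 1, 3, 2 (mod 4)`.
[cite: BarriosEtAl2025, Thm. 5.1, §5 tables (v(d) = 0, 1), rows I₀] -/
theorem BarriosEtAl2025.localTamagawaNumber_quadraticTwist_two_mem_of_goodReduction_of_local
    (h : BarriosEtAl2025_quadraticTwist_two_of_goodReduction) :
    BarriosEtAl2025.localTamagawaNumber_quadraticTwist_two_mem_of_goodReduction := by
  intro W _ hgood d hd Wd _ Cd hWd
  obtain ⟨m, e, he, hme, hm⟩ := exists_int_mul_sq_eq_and_not_four_dvd hd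
  have hm0 : (m : ℚ) ≠ 0 := by
    rintro h0
    rw [h0, zero_mul] at hme
    exact hd hme.symm
  -- `Wd = (Cd * C) • W^{(m)}` over `ℚ`
  obtain ⟨C, hC⟩ := W.exists_variableChange_quadraticTwist_mul_sq (m : ℚ) e he
  have hWd' : Wd = (Cd * C) • W.quadraticTwist (m : ℚ) := by
    rw [mul_smul, hC, hme, hWd]
  -- base change to `ℚ₂`
  set X : WeierstrassCurve ℚ_[2] := W.baseChange ℚ_[2] with hX
  haveI : X.IsElliptic := inferInstanceAs (W.map (algebraMap ℚ ℚ_[2])).IsElliptic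
  have hm2 : ((m : ℚ) : ℚ_[2]) ≠ 0 := by exact_mod_cast hm0
  haveI : (X.quadraticTwist ((m : ℚ) : ℚ_[2])).IsElliptic := X.isElliptic_quadraticTwist hm2
  have hbc : Wd.baseChange ℚ_[2] =
      (Cd * C).map (algebraMap ℚ ℚ_[2]) • X.quadraticTwist ((m : ℚ) : ℚ_[2]) := by
    rw [hWd', VariableChange.baseChange_smul_eq, hX, baseChange, map_quadraticTwist]
    rfl
  rw [hbc, localTamagawaNumber_variableChange_holds (R := ℤ_[2])
    (X.quadraticTwist ((m : ℚ) : ℚ_[2])) _]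
  -- good reduction of `W` at `2` IS good reduction of the minimal model of `X = W ⊗ ℚ₂`
  have hE : (X.minimal ℤ_[2]).HasGoodReduction ℤ_[2] := hgood
  have hcast : ((m : ℚ) : ℚ_[2]) = ((m : ℤ) : ℚ_[2]) := by push_cast; rfl
  rw [hcast]
  rcases hm with hm | hm | hm
  · rw [((h X hE m).1 hm).2]; simp
  · exact ((h X hE m).2.2 hm).2
  · exact ((h X hE m).2.1 hm).2

/-! ### APPEND (team x11b3 LEAD DEAL #4 A4.1 (1): the WANTED bookkeeping corollary, stated on the
HOME fact `BarriosEtAl2025.localTamagawaNumber_quadraticTwist_two_mem_of_goodReduction` (p251464)) -/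

/-- **No odd prime divides `c₂` of a quadratic twist of a curve with good reduction at `2`**
(bookkeeping on Barrios et al. 2025, Thm. 5.1, rows `I₀`: `c₂ ∈ {1, 2, 4}`). Under the HOME fact:
for `W / ℚ` elliptic with good reduction at `2`, `d ∈ ℚ^×`, any model `Wd` of `W^{(d)}` over `ℚ`
and any prime `p ≠ 2`, `p ∤ c₂(Wd)`. This is the shape of the cell's "binder at `2`"
(`hbind` / `h2tw` of `Summits/…/X11b/Three/TamagawaTwistAnyDiscr.lean`, `UpperShimuraOdd.lean`),
at every odd `p` (the team's instance is `p = 3`).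
[cite: BarriosEtAl2025, Thm. 5.1, §5 tables (v(d) = 0, 1), rows I₀] -/
theorem BarriosEtAl2025.not_dvd_localTamagawaNumber_quadraticTwist_two_of_goodReduction_of_ne_two
    (h : BarriosEtAl2025.localTamagawaNumber_quadraticTwist_two_mem_of_goodReduction)
    (W : WeierstrassCurve ℚ) [W.IsElliptic] (hW : W.HasGoodReductionAtPrime 2) {d : ℚ} (hd : d ≠ 0)
    (Wd : WeierstrassCurve ℚ) [Wd.IsElliptic] (Cd : VariableChange ℚ)
    (hWd : Cd • W.quadraticTwist d = Wd) (p : ℕ) (hp : p.Prime) (hp2 : p ≠ 2) :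
    ¬ p ∣ (Wd.baseChange ℚ_[2]).localTamagawaNumber ℤ_[2] := by
  have hmem := h W hW d hd Wd Cd hWd
  simp only [Set.mem_insert_iff, Set.mem_singleton_iff] at hmem
  have key : ¬ p ∣ 2 := fun h2 ↦ hp2 ((Nat.prime_dvd_prime_iff_eq hp Nat.prime_two).mp h2)
  rcases hmem with hc | hc | hc <;> rw [hc]
  · exact fun h1 ↦ hp.one_lt.ne' (Nat.dvd_one.mp h1)
  · exact key
  · exact fun h4 ↦ key (hp.dvd_of_dvd_pow (show p ∣ 2 ^ 2 by simpa using h4))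

/-- The same for the LOCAL fact (p251509), through the bridge. Bookkeeping.
[cite: BarriosEtAl2025, Thm. 5.1, §5 tables (v(d) = 0, 1), rows I₀] -/
theorem not_dvd_localTamagawaNumber_quadraticTwist_two_of_goodReduction_of_ne_two
    (h : BarriosEtAl2025_quadraticTwist_two_of_goodReduction)
    (W : WeierstrassCurve ℚ) [W.IsElliptic] (hW : W.HasGoodReductionAtPrime 2) {d : ℚ} (hd : d ≠ 0)
    (Wd : WeierstrassCurve ℚ) [Wd.IsElliptic] (Cd : VariableChange ℚ)
    (hWd : Cd • W.quadraticTwist d = Wd) (p : ℕ) (hp : p.Prime) (hp2 : p ≠ 2) :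
    ¬ p ∣ (Wd.baseChange ℚ_[2]).localTamagawaNumber ℤ_[2] :=
  BarriosEtAl2025.not_dvd_localTamagawaNumber_quadraticTwist_two_of_goodReduction_of_ne_two
    (BarriosEtAl2025.localTamagawaNumber_quadraticTwist_two_mem_of_goodReduction_of_local h)
    W hW hd Wd Cd hWd p hp hp2

end Literature.NumberTheory.EllipticCurves

end
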